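import Summits.CriticalPhenomena.PercolationContinuityZ3.Theorems.PercNearOneGluingNoHeavyQuantLightResidDEC
import Summits.CriticalPhenomena.PercolationContinuityZ3.Theorems.PercNearOneGluingNoHeavyQuantResidualDECFree
import HarnessLib

/-!
# QUANT lane R8, T-DEC: THE LAYER-FREE FORM OF THE LIGHT NODE — a `DECFree` certificate of the residual at the CAPPED floor `min (a·x) (1/2)`
# is a `LightResidDECAt` certificate; the conjecture `LightResidDECFree` (every residual has one) and `LightResidDECFree ⟹ LightResidDEC ⟹ FarTreeRow`
# (arm-1 gen 50, architect)

builds on p205010 (kernel theorem, internal audit signed; external expert review pending)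

Statement + support file (`--supports stmt-CriticalPhenomena-4575`), QUANT lane seat prim-quant-arm-1 (gen 50, architect), rung R8 of
`run/shared/lean/prim/quant/LADDER.md`; memo `run/shared/lean/prim/quant/prim-quant-arm-1-g50/ARCH-G50.md` §2′.  One `@[conjecture]`
(`LightResidDECFree`); theorems with standard axioms, no sorries.  Uses census-1 g24's layer-free certificate `LawDec.DECFree` /
`decAt_of_decFree` (✓ `…QuantResidualDECFree`) and the light node `LightResidDECAt` / `LightResidDEC` (✓ p447494 `…QuantLightResidDEC`).

WHY.  Census-1 g24 (RESID-DEC-G24 §7): at the NATURAL floor the layer-free certificate `DECFree (a·x) (a·fmean L)` of the residual fails on some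
composite `k = 3` forests at near-sure floors `x ≥ .93` (per-layer DEC still holds) — so "ResidDECFree" is false as a node.  ARCH-G50 §2′ (this seat,
exact rationals): at the CAPPED floor `min (a·x) (1/2)` — all the light induction asks — NO layer-free failure is known: on ≈ 62 000 (forest, outer
gate) pairs (identical glued heavy forests `k ≤ 16`; 2 888 random heavy-biased forests with unequal gates `.9–.999` and glued / chain / cherry /
gapped sub-forests; 3 200 forests with DEEP random sub-forests of depth ≤ 3, branching ≤ 3, non-caterpillar) the four closed-form criteria
(`…QuantLightResidDECCriteria`) certify all but 11 pairs, and those 11 (all `k = 3`, capped floor `y ∈ [.42, .50]`, budget ratio `D/B ∈ [1.04, 3.5]`)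
are `DECFree` at the capped floor by an exact LP; 0 per-layer-only, 0 failures.  Hence the sharpest candidate node is layer-free:
* `lightResidDECAt_of_decFree` — a `DECFree (min (a·x) (1/2)) (a·fmean L) (ftop L)` certificate of `resid a (wco a L) L` gives `LightResidDECAt x a L`;
* `def LightResidDECFreeOn fam` (schema) and **`@[conjecture] LightResidDECFree := LightResidDECFreeOn SibFam₃`**: every residual of a list of
  `≥ 3` tree-OK composite siblings is `DECFree` at the capped floor, for every outer gate `a ∈ (0,1)`;
* `lightResidDECOn_of_freeOn`, **`lightResidDEC_of_lightResidDECFree`**, **`Quant.farTreeRow_of_lightResidDECFree`** (unconditional).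

HONEST STATUS: `LightResidDECFree` is EVIDENCE-LEVEL (census above) and STRONGER than `LightResidDEC`; all of `LightResidDEC`, `LightSiblingStep`,
`ResidDEC`, `SiblingStep`, `FarTreeRow` OPEN.  RATE class log\* / honest sentence of `run/shared/lean/prim/quant/README.md` unchanged.  [this work];
`DECFree`: prim-quant-census-1 g24.  Nothing here is cited as a published result.  The gluing rows served [cite: KozmaNitzan2024, Conjecture 3 (p. 15)];
product measure [cite: Grimmett1999, §1.3 p. 10].
-/

noncomputable section

open scoped BigOperators

namespace Summit.CriticalPhenomena.PercolationContinuityZ3.Theorems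
namespace Quant
namespace LawDec

open Finset

/-- **A LAYER-FREE CERTIFICATE AT THE CAPPED FLOOR IS A LIGHT CERTIFICATE**: `DECFree (min (a·x) (1/2)) (a·fmean L) (ftop L) (resid a (wco a L) L)`
gives `LightResidDECAt x a L` (`decAt_of_decFree`; at least two tree-OK siblings so that the residual has mean `a·fmean L`). [this work] -/
theorem lightResidDECAt_of_decFree {x a : ℝ} (ha0 : 0 < a) (ha1 : a < 1) (L : List Sib) (hL : ∀ s ∈ L, s.TreeOK x) (hk : 2 ≤ L.length)
    (hR : DECFree (min (a * x) (1 / 2)) (a * fmean L) (ftop L) (resid a (wco a L) L)) : LightResidDECAt x a L := by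
  have hL' : ∀ s ∈ L, s.LawOK := fun s hs => (hL s hs).lawOK
  obtain ⟨_, hw, hw1⟩ := wco_admissible ha1 L hL hk
  obtain ⟨_, _, _, rmn⟩ := resid_laws ha0 ha1.le L hL' hw hw1
  exact fun j _ => decAt_of_decFree hR rmn j

/-- **LAYER-FREE LIGHT RESID-DEC ON A FAMILY OF SIBLING LISTS** (schema; a refuted variant lands as `¬ LightResidDECFreeOn fam`): for every list of the
family at floor `0 < x < 1` and every outer gate `0 < a < 1`, the residual at the canonical weight is `DECFree` at the capped floor `min (a·x) (1/2)`
with target its mean `a·fmean L`. [this work] -/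
def LightResidDECFreeOn (fam : ℝ → List Sib → Prop) : Prop :=
  ∀ (x : ℝ) (L : List Sib), 0 < x → x < 1 → fam x L → ∀ a : ℝ, 0 < a → a < 1 →
    DECFree (min (a * x) (1 / 2)) (a * fmean L) (ftop L) (resid a (wco a L) L)

/-- the schema is antitone in the family. [this work] -/
theorem LightResidDECFreeOn.mono {fam fam' : ℝ → List Sib → Prop} (h : LightResidDECFreeOn fam) (hff : ∀ x L, fam' x L → fam x L) :
    LightResidDECFreeOn fam' :=
  fun x L hx0 hx1 hf => h x L hx0 hx1 (hff x L hf)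

/-- **a layer-free light family certificate is a light family certificate** (families of lists of `≥ 2` tree-OK siblings). [this work] -/
theorem lightResidDECOn_of_freeOn {fam : ℝ → List Sib → Prop} (hfam : ∀ x L, fam x L → (∀ s ∈ L, s.TreeOK x) ∧ 2 ≤ L.length)
    (h : LightResidDECFreeOn fam) : LightResidDECOn fam :=
  fun x L hx0 hx1 hf a ha0 ha1 =>
    lightResidDECAt_of_decFree ha0 ha1 L (hfam x L hf).1 (hfam x L hf).2 (h x L hx0 hx1 hf a ha0 ha1)

/-- **CONJECTURE `LIGHT RESID-DEC, LAYER-FREE` (arm-1 g50 ARCH-G50 §2′).**  For every forest of `k ≥ 3` tree-built composite siblings at floor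
`0 < x < 1` (`SibFam₃`) and every outer gate `0 < a < 1`, the top-level residual `resid a (wco a L) L` is `DECFree` at the CAPPED floor
`min (a·x) (1/2)` with target `a·fmean L`: an exact mixture of singles `2·lo ≥ T` and pairs `{lo, hi; g}` with `g ≥ y`, `2·lo + (hi − lo)·g ≥ T` —
ONE certificate valid at every layer.  KERNEL FACTS: `LightResidDECFree ⟹ LightResidDEC ⟹ LightSiblingStep ⟹ Quant.FarTreeRow` unconditionally.
It is STRONGER than `LightResidDEC`; its natural-floor analogue is false (census-1 g24 RESID-DEC-G24 §7: composite `k = 3` at `x ≥ .93`).  EVIDENCE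
(ARCH-G50 §2′, exact): ≈ 62 000 (forest, a) pairs incl. ≈ 4 400 heavy forests, deep non-caterpillar sub-forests, unequal gates to `.999`: 0 failures
(four closed-form criteria on all but 11; exact layer-free LP on those).  builds on p205010 (kernel theorem, internal audit signed; external expert
review pending). [this work] [status: open] -/
@[conjecture] def LightResidDECFree : Prop :=
  LightResidDECFreeOn SibFam₃

/-- **`LightResidDECFree ⟹ LightResidDEC`.** [this work] -/
theorem lightResidDEC_of_lightResidDECFree (h : LightResidDECFree) : LightResidDEC :=
  lightResidDECOn_of_freeOn (fun _ _ hf => ⟨hf.1, le_trans (by norm_num) hf.2⟩) h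

end LawDec

/-- **`LightResidDECFree ⟹ Quant.FarTreeRow`, UNCONDITIONALLY.** [this work] -/
theorem farTreeRow_of_lightResidDECFree (h : LawDec.LightResidDECFree) : FarTreeRow :=
  farTreeRow_of_lightResidDEC (LawDec.lightResidDEC_of_lightResidDECFree h)

end Quant
end Summit.CriticalPhenomena.PercolationContinuityZ3.Theorems
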